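import Mathlib
import HarnessLib
import Summits.Ventures.LatticeQCDFlow.Scoring.TranslationAverageTwoPoint
import Summits.Ventures.LatticeQCDFlow.Scoring.HMCKernelSymmetry

/-!
# The measured charge DENSITY along arm E2's run: zero mean at every site, in every slab and every sub-volume, at every step; its two-point function depends on the separation only

HONEST FRAMING: exact (Metropolis-corrected) sampling algorithms for lattice gauge theory;
figures of merit are autocorrelation/cost numbers at stated couplings and volumes; no
continuum-physics claim.

Venture `LatticeQCDFlow` (cell pub-lqcd), sub-topic `Scoring`, FANOUT row 21 (`su3-base`, arm `E2 = PBC-HMC`; the run records the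
flowed charge density per site / per time slice, not only the total charge).  NEW WORK of the cell: row 16's `HMCKernelSymmetry`
proved `E_N[Q] = 0` for the TOTAL measured charge at every step; row 16's `WilsonFlowRK3Reflection` has the per-site statement in
EQUILIBRIUM.  Here: the per-site / per-slab statement ALONG THE RUN, from row 16's `conjKernel_hmcKernel` (the kernel commutes with
`Θ'`), row 21's `HMCKernelTranslation` (`hmcChain_law_map_torusConfigShift`) and `TranslationAverageTwoPoint` (site fields under
translation-invariant laws), row 16's `cloverPseudoscalar_iterate_wilsonFlowRK3_negReflect_zero_site` (the density at the origin is
`Θ'`-odd).  Def-free; nothing is cited as a fact; no number.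

* **`integral_hmcChain_rk3CloverDensity_eq_zero`** — from any start invariant under `Θ'` and under all translations (cold, hot),
  at every step `N`, `E_N[q_x] = 0` at EVERY site `x` (`q_x = P_x ∘ RK3_{ε'}^m`); **`integral_hmcChain_sum_rk3CloverDensity_eq_zero`**
  — hence `E_N[Σ_{x∈S} q_x] = 0` for EVERY finite set of sites (slabs, sub-volumes), probability start;
  `integral_hmcChain_rk3CloverDensity_mul_translate` — `E_N[q_x q_y] = E_N[q_0 q_{y−x}]`; cold / hot corollaries.
NOT CLAIMED: arm E1; stationarity; the sign or decay of the two-point function; numbers.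
-/

noncomputable section

open MeasureTheory ProbabilityTheory
open Literature.MathematicalPhysics.QuantumFieldTheory
open Literature.MathematicalPhysics.QuantumFieldTheory.Luscher2010 (SuBasis)
open Literature.MathematicalPhysics.QuantumLattice (fundamentalRep cloverPseudoscalar)
open Summit.Ventures.LatticeQCDFlow.Exactness (nHit isMarkovKernel_nHit)

namespace Summit.Ventures.LatticeQCDFlow.Scoring

variable {L n : ℕ} [NeZero L] (B : SuBasis n) (β ε : ℝ) (w : List MDOp)

/-- **`E_N[q_x] = 0` AT EVERY SITE AND EVERY STEP**: from any start invariant under the time reflection `Θ'` and under all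
translations, the measured charge density `q_x = P_x ∘ RK3_{ε'}^m` has zero mean at every site at every HMC step (translate `x`
to the origin, where the density is `Θ'`-odd, and use the `Θ'`-invariance of the `N`-step law). -/
theorem integral_hmcChain_rk3CloverDensity_eq_zero {μ₀ : Measure (GaugeConfig 4 L (Matrix.specialUnitaryGroup (Fin n) ℂ))}
    (hR : μ₀.map GaugeConfig.negReflect = μ₀) (hT : ∀ v : Site 4 L, μ₀.map (TorusTranslation.torusConfigShift v) = μ₀)
    (N : ℕ) (ε' : ℝ) (m : ℕ) (x : Site 4 L) :
    ∫ U, cloverPseudoscalar (fundamentalRep (Fin n)) x ((wilsonFlowRK3 ε')^[m] U) ∂(μ₀.bind (nHit (hmcKernel B β ε w) N)) = 0 := by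
  rw [integral_siteField_eq_origin (hmcChain_law_map_torusConfigShift B β ε w · (hT _) N)
    (fun x U => cloverPseudoscalar (fundamentalRep (Fin n)) x ((wilsonFlowRK3 ε')^[m] U))
    (fun v x U => rk3CloverDensity_torusConfigShift ε' m v x U) x]
  exact integral_eq_zero_of_measurePreserving_odd WilsonSiteRP.negReflectEquiv
    ⟨WilsonSiteRP.negReflectEquiv.measurable, map_bind_nHit_eq_self (conjKernel_hmcKernel B β ε w) hR N⟩
    (fun U => cloverPseudoscalar_iterate_wilsonFlowRK3_negReflect_zero_site ε' m U)

/-- **`E_N[Σ_{x∈S} q_x] = 0` FOR EVERY FINITE SET OF SITES** (slabs, sub-volumes, the whole torus) at every step, from any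
probability start invariant under `Θ'` and all translations. -/
theorem integral_hmcChain_sum_rk3CloverDensity_eq_zero {μ₀ : Measure (GaugeConfig 4 L (Matrix.specialUnitaryGroup (Fin n) ℂ))}
    [IsProbabilityMeasure μ₀] (hR : μ₀.map GaugeConfig.negReflect = μ₀)
    (hT : ∀ v : Site 4 L, μ₀.map (TorusTranslation.torusConfigShift v) = μ₀) (N : ℕ) (ε' : ℝ) (m : ℕ) (S : Finset (Site 4 L)) :
    ∫ U, ∑ x ∈ S, cloverPseudoscalar (fundamentalRep (Fin n)) x ((wilsonFlowRK3 ε')^[m] U) ∂(μ₀.bind (nHit (hmcKernel B β ε w) N)) = 0 := by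
  haveI := isMarkovKernel_nHit (hmcKernel B β ε w (d := 4) (L := L)) N
  have hint : ∀ x ∈ S, Integrable (fun U : GaugeConfig 4 L (Matrix.specialUnitaryGroup (Fin n) ℂ) =>
      cloverPseudoscalar (fundamentalRep (Fin n)) x ((wilsonFlowRK3 ε')^[m] U)) (μ₀.bind (nHit (hmcKernel B β ε w) N)) :=
    fun x _ => integrable_of_continuous_sunConfig
      ((Literature.MathematicalPhysics.QuantumLattice.continuous_cloverPseudoscalar _
        (Literature.MathematicalPhysics.QuantumLattice.continuous_fundamentalRep (Fin n)) x).comp (continuous_iterate_wilsonFlowRK3 ε' m))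
  rw [integral_finsetSum S hint]
  exact Finset.sum_eq_zero fun x _ => integral_hmcChain_rk3CloverDensity_eq_zero B β ε w hR hT N ε' m x

/-- **The two-point function of the measured density along the run depends on the separation only**:
`E_N[q_x q_y] = E_N[q_0 q_{y−x}]` at every step from any translation-invariant start. -/
theorem integral_hmcChain_rk3CloverDensity_mul_translate {μ₀ : Measure (GaugeConfig 4 L (Matrix.specialUnitaryGroup (Fin n) ℂ))}
    (hT : ∀ v : Site 4 L, μ₀.map (TorusTranslation.torusConfigShift v) = μ₀) (N : ℕ) (ε' : ℝ) (m : ℕ) (x y : Site 4 L) :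
    ∫ U, cloverPseudoscalar (fundamentalRep (Fin n)) x ((wilsonFlowRK3 ε')^[m] U) *
        cloverPseudoscalar (fundamentalRep (Fin n)) y ((wilsonFlowRK3 ε')^[m] U) ∂(μ₀.bind (nHit (hmcKernel B β ε w) N)) =
      ∫ U, cloverPseudoscalar (fundamentalRep (Fin n)) 0 ((wilsonFlowRK3 ε')^[m] U) *
        cloverPseudoscalar (fundamentalRep (Fin n)) (y - x) ((wilsonFlowRK3 ε')^[m] U) ∂(μ₀.bind (nHit (hmcKernel B β ε w) N)) :=
  integral_siteField_mul_translate (hmcChain_law_map_torusConfigShift B β ε w · (hT _) N)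
    (fun x U => cloverPseudoscalar (fundamentalRep (Fin n)) x ((wilsonFlowRK3 ε')^[m] U))
    (fun x U => cloverPseudoscalar (fundamentalRep (Fin n)) x ((wilsonFlowRK3 ε')^[m] U))
    (fun v x U => rk3CloverDensity_torusConfigShift ε' m v x U) (fun v x U => rk3CloverDensity_torusConfigShift ε' m v x U) x y

/-- Cold start (`U ≡ 1`): `E_N[q_x] = 0` at every site and step. -/
theorem integral_hmcColdStart_rk3CloverDensity_eq_zero (N : ℕ) (ε' : ℝ) (m : ℕ) (x : Site 4 L) :
    ∫ U, cloverPseudoscalar (fundamentalRep (Fin n)) x ((wilsonFlowRK3 ε')^[m] U)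
      ∂((Measure.dirac (1 : GaugeConfig 4 L (Matrix.specialUnitaryGroup (Fin n) ℂ))).bind (nHit (hmcKernel B β ε w) N)) = 0 :=
  integral_hmcChain_rk3CloverDensity_eq_zero B β ε w dirac_one_map_negReflect dirac_one_map_torusConfigShift N ε' m x

/-- Cold start: `E_N[Σ_{x∈S} q_x] = 0` for every finite set of sites at every step. -/
theorem integral_hmcColdStart_sum_rk3CloverDensity_eq_zero (N : ℕ) (ε' : ℝ) (m : ℕ) (S : Finset (Site 4 L)) :
    ∫ U, ∑ x ∈ S, cloverPseudoscalar (fundamentalRep (Fin n)) x ((wilsonFlowRK3 ε')^[m] U)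
      ∂((Measure.dirac (1 : GaugeConfig 4 L (Matrix.specialUnitaryGroup (Fin n) ℂ))).bind (nHit (hmcKernel B β ε w) N)) = 0 :=
  integral_hmcChain_sum_rk3CloverDensity_eq_zero B β ε w dirac_one_map_negReflect dirac_one_map_torusConfigShift N ε' m S

/-- Hot start (`∏ dHaar`): `E_N[q_x] = 0` at every site and step. -/
theorem integral_hmcHotStart_rk3CloverDensity_eq_zero (N : ℕ) (ε' : ℝ) (m : ℕ) (x : Site 4 L) :
    ∫ U, cloverPseudoscalar (fundamentalRep (Fin n)) x ((wilsonFlowRK3 ε')^[m] U)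
      ∂((Measure.pi fun _ : Edge 4 L => haarProbability (Matrix.specialUnitaryGroup (Fin n) ℂ)).bind (nHit (hmcKernel B β ε w) N)) = 0 :=
  integral_hmcChain_rk3CloverDensity_eq_zero B β ε w piHaar_map_negReflect piHaar_map_torusConfigShift N ε' m x

/-- Hot start: `E_N[Σ_{x∈S} q_x] = 0` for every finite set of sites at every step. -/
theorem integral_hmcHotStart_sum_rk3CloverDensity_eq_zero (N : ℕ) (ε' : ℝ) (m : ℕ) (S : Finset (Site 4 L)) :
    ∫ U, ∑ x ∈ S, cloverPseudoscalar (fundamentalRep (Fin n)) x ((wilsonFlowRK3 ε')^[m] U)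
      ∂((Measure.pi fun _ : Edge 4 L => haarProbability (Matrix.specialUnitaryGroup (Fin n) ℂ)).bind (nHit (hmcKernel B β ε w) N)) = 0 :=
  integral_hmcChain_sum_rk3CloverDensity_eq_zero B β ε w piHaar_map_negReflect piHaar_map_torusConfigShift N ε' m S

/-- Cold start: `E_N[q_x q_y] = E_N[q_0 q_{y−x}]` at every step. -/
theorem integral_hmcColdStart_rk3CloverDensity_mul_translate (N : ℕ) (ε' : ℝ) (m : ℕ) (x y : Site 4 L) :
    ∫ U, cloverPseudoscalar (fundamentalRep (Fin n)) x ((wilsonFlowRK3 ε')^[m] U) *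
        cloverPseudoscalar (fundamentalRep (Fin n)) y ((wilsonFlowRK3 ε')^[m] U)
        ∂((Measure.dirac (1 : GaugeConfig 4 L (Matrix.specialUnitaryGroup (Fin n) ℂ))).bind (nHit (hmcKernel B β ε w) N)) =
      ∫ U, cloverPseudoscalar (fundamentalRep (Fin n)) 0 ((wilsonFlowRK3 ε')^[m] U) *
        cloverPseudoscalar (fundamentalRep (Fin n)) (y - x) ((wilsonFlowRK3 ε')^[m] U)
        ∂((Measure.dirac (1 : GaugeConfig 4 L (Matrix.specialUnitaryGroup (Fin n) ℂ))).bind (nHit (hmcKernel B β ε w) N)) :=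
  integral_hmcChain_rk3CloverDensity_mul_translate B β ε w dirac_one_map_torusConfigShift N ε' m x y

end Summit.Ventures.LatticeQCDFlow.Scoring
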